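import Literature.MathematicalPhysics.QuantumFieldTheory.Balaban1983to89.B9SectBL2GReadCodedY
import Literature.MathematicalPhysics.QuantumFieldTheory.Balaban1983to89.B9SectBL2SecondOrderY
import Literature.MathematicalPhysics.QuantumFieldTheory.Balaban1983to89.B9SectBGClassLettersY

/-!
# `Balaban1983to89.B9SectBL2GCrossY` — EVERY ORIENTATION OF THE SIX `L²` BOND LETTERS OF NODE 00's `KACU` AT A BASE («we may always replace ∇_U by ∇*_U,
# and vice versa», p. 398) — the field `readGL2` of gen 14's `L2GFrame₇` at the letters, from the printed orientations of `B9SectBL2GReadCodedY` by the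
# block-`ℓ²` cross ∕ second-order conversions of `B9Eq38CrossLettersL2` ∕ `B9Eq38SecondOrderCrossL2` on the bond carrier (pub-ymgap N06 row 13, G side)

T. Bałaban, *Propagators for lattice gauge theories in a background field*, Commun. Math. Phys. **99** (1985) 389–434
[`Balaban1985BackgroundPropagators`, "B9"], Thm 3.1 (3.46) p. 398 + first remark p. 398, Thm 3.3 p. 399, (3.3) p. 390, (3.8) p. 392, p. 404 (after (3.69));
[4] = T. Bałaban, *Propagators and renormalization transformations for lattice gauge theories. II*, Commun. Math. Phys. **96** (1984) 223–250
[`Balaban1984PropagatorsII`], Prop. 2.6 (2.140)–(2.141) p. 247, Lemma 2.1 p. 234.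

statement-level skeleton of published theorems with citation tags; proofs where landed; nothing here is a claim about the Yang–Mills mass gap

WHY THIS FILE (seat dag-n06-c gen 14).  `B9SectBL2GReadCodedY.readGL2_GbC_printed` reads print's five orientations of the (3.46) words of G(U) off the record
(`GbC`, `∇♯_{inl}·GbC`, `GbC·∇♯_{inr}`, `∇♯_{inl}∇♯_{inl}·GbC`, `∇♯_{inl}·GbC·∇♯_{inr}`, `GbC·∇♯_{inr}∇♯_{inr}`); the frame `L2GFrame₇.readGL2` asks for all `k, l ∈ κ ⊕ κ`.
This file is the bond-carrier twin of this lineage's gen-9 site files `B9SectBL2TransferInY` §2 ∕ `B9SectBL2SecondOrderY` §1: the SAME generic bricks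
(`hasL2Majorant_cross_left ∕ _right`, `hasL2Majorant_cross2_left_inner ∕ _right_inner`) at the carrier `S′ = κ × SiteY`, shifts `bT shiftY`, variables
`bU (U_□)` — whose stencils, unit norms, commuting shifts and plaquettes are the site ones read at the second component.  §0 bond-carrier facts (`bT`∕`bU`
pointwise, the plaquette law `PlaqLawY` from the class law `Reg335PlaqY`); §1 ★★ `readGL2_GbC_all` — given [4] Lemma 2.1 at `(δ₀, 1/12)`, the transfers of `ℓ`
and `ℓ⁻²` (constant `Λ ≧ 1`) and `PlaqLawY c_P U`, the six families for ALL orientations at rate `δ₀/2` with constant `cLGY·B₀`, `cLGY = g_X²·g_I·c_L`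
(`g_X = 1 + c_S Λ c₁`, `g_I = 1 + c₁c_L'(e^{δ₀d₀}Λ + c_Pσ₁e^{2δ₀d₀}Λ)`, `σ₁ = Λe^{δ₀d₀/12}`).

HONEST SCOPE.  Bookkeeping over NODE 00's DEFINED readings, gen 13's letters and the generic `ℓ²` bricks; the Lemma-2.1 datum, the transfers and the plaquette
law are HYPOTHESES here (discharged by the instance from `B9SectBGpFrameCodedY.exists_d261`, `scaleTransfer6_window_geo9Y`, the displayed class law).
COUNT-NEUTRAL; N06 NOT discharged; nothing continuum ∕ OS ∕ mass-gap ∕ Clay.  Cell `pub-ymgap` (HUMAN RULING D-0062), Track A node N06 [B9], row 13, 2026-08-29.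

RELATED IN THE TREE, NOT DUPLICATED (used by name): `B9SectBL2GReadCodedY.readGL2_GbC_printed`, `B9Eq38CrossLettersL2`, `B9Eq38SecondOrderCrossL2`,
`B9SectBL2SecondOrderY` (`PlaqLawY`, `plaqLawY_of_holonomy_bound`, `shiftY_comm`, `eta_le_len`), `B9Eq370SecondOrderConversionL2.le_of_scaleTransfer`,
`B9SectBGClassLettersY.Reg335PlaqY`, `B9SectBGpLettersY` (`stencilF_blkC`, `stencilB_blkC`).
-/

noncomputable section

namespace Literature.MathematicalPhysics.QuantumFieldTheory.Balaban1983to89.B9SectBL2GCrossY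

open B6Ineq2142KLevelV1 (β)
open B6KLevelCensusIndexV1 (KIdx kGeo)
open B6RandomWalk (Triangle254 Ineq261)
open B6RandomWalkL2 (HasL2Majorant hasL2Majorant_mono)
open B9Thm34Ext (toB6)
open B9Ineq347 (ScaleTransfer)
open B9FromB6 (L2Block)
open B9Eq39Adjoint (R plaqU)
open B9Eq369Small (Through through_self)
open B9Eq352DivFormLetters (conj)
open B9Eq352GradLetters (diffLetter)
open B9Eq371GradLetters (bT bU)
open B9Ineq363L2 (hasL2Majorant_rate_mono)
open B9PinMembersKLevelV1 (MemberY geo9Y bg9Y)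
open B9Eq360DeltaPrimeAY (AfldY)
open B9SectBGpLettersY (GVal coordC blkC stencilF_blkC stencilB_blkC norm_le_one_and_inv_of_mem)
open B9SectBL2DictionaryY (coordC_base_eq)
open B9SectBCodedReadingsU (KACU)
open B9SectBGWordDeltaAY (GbC)
open B9SectBGClassLettersY (Reg335PlaqY)
open B9SectBL2GReadCodedY (readGL2_GbC_printed)
open B9SectBL2SecondOrderY (PlaqLawY plaqLawY_of_holonomy_bound shiftY_comm)
open B9Eq38CrossLettersL2 (hasL2Majorant_cross_left hasL2Majorant_cross_right)
open B9Eq38SecondOrderCrossL2 (hasL2Majorant_cross2_left_inner hasL2Majorant_cross2_right_inner)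
open B9Eq370SecondOrderConversionL2 (le_of_scaleTransfer)
open B9GeoLemma21KLevelV1 (geo9Y_dist_triangle geo9Y_len_pos geo9K_eta_pos geo9K_one_le_L)
open B9RWSums347DefiniteFacesWindow (geo9Y_dist_nonneg)
open Node00 (SiteY BlkY IBondY CfgY SiteParY BondParY UboxY shiftY GAY GpY)

variable {d ℓ : ℕ} {hd : 1 ≤ d + 1} {hL : Odd (ℓ + 1) ∧ 1 < ℓ + 1} {b₀ b₁ : ℝ}
variable {𝔸 : Type} [NormedRing 𝔸] [NormedAlgebra ℂ 𝔸] [CompleteSpace 𝔸]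
variable {ι : Type} [Fintype ι] [DecidableEq ι]

/-- ★ **THE CONSTANT OF THE ALL-ORIENTATION `L²` READING** (member-independent; linear factor of `B₀` removed): `g_X²·g_I·c_L` with `c_L = s_ι·M₂·S_b`,
`g_X = 1 + (M₂S_bs_ιe^{δ₀d₀})Λc₁`, `g_I = 1 + c₁M₂S_bs_ι(e^{δ₀d₀}Λ + c_P(Λe^{δ₀d₀/12})e^{2δ₀d₀}Λ)`, `d₀ = 2(d+1)`, `c₁ = c₁(dL, δ₀, 1/12)`.
[cite: Balaban1985BackgroundPropagators, p.398 (first remark), p.403 l.1–9 («of course with different constants»), bookkeeping] -/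
def cLGY (cP M₂ Sb sι : ℝ) (d dL : ℕ) (δ₀ Λ : ℝ) : ℝ :=
  (1 + ((1 : ℝ) ^ 2 * M₂ * Sb * sι * Real.exp (δ₀ * (2 * ((d : ℝ) + 1)))) * Λ * B6.c1 dL δ₀ (1 / 12)) ^ 2 *
    (1 + B6.c1 dL δ₀ (1 / 12) * M₂ * Sb * sι *
      ((1 : ℝ) ^ 2 * Real.exp (δ₀ * (2 * ((d : ℝ) + 1))) * Λ
        + (1 : ℝ) ^ 4 * cP * (Λ * Real.exp (1 / 12 * δ₀ * (2 * ((d : ℝ) + 1)))) * Real.exp (δ₀ * (2 * (2 * ((d : ℝ) + 1)))) * Λ)) *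
    (sι * M₂ * Sb)

omit [NormedRing 𝔸] [NormedAlgebra ℂ 𝔸] [CompleteSpace 𝔸] [Fintype ι] [DecidableEq ι] in
/-- `0 < cLGY` once `M₂S_bs_ι > 0`… we only need `0 ≤ cLGY`. [cite: Balaban1985BackgroundPropagators, p.403 l.1–9, bookkeeping] -/
theorem cLGY_nonneg {cP M₂ Sb sι : ℝ} (hcP : 0 ≤ cP) (hM₂ : 0 ≤ M₂) (hSb : 0 ≤ Sb) (hsι : 0 ≤ sι) (d dL : ℕ) (δ₀ : ℝ) {Λ : ℝ} (hΛ : 0 ≤ Λ) :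
    0 ≤ cLGY cP M₂ Sb sι d dL δ₀ Λ := by
  have := B6RandomWalk.c1_nonneg dL δ₀ (1 / 12)
  unfold cLGY; positivity

/-! ## §0  Bond-carrier facts: `bT`, `bU` read at the second component; the plaquette law from the class law -/

section Facts

variable {Mstar : ℕ} (G : Subgroup 𝔸ˣ) (x : MemberY d ℓ hd hL b₀ b₁ Mstar) (ιB : BlkY x.toKIdx → IBondY x.toKIdx)

omit [NormedAlgebra ℂ 𝔸] [CompleteSpace 𝔸] [Fintype ι] [DecidableEq ι] in
/-- `bT T μ (k, z) = (k, T μ z)` (`rfl`). [cite: Balaban1985BackgroundPropagators, (3.3) p.390, dictionary] -/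
theorem bT_apply (μ : Fin (d + 1)) (q : Fin (d + 1) × SiteY x.toKIdx) : bT (shiftY x.toKIdx) μ q = (q.1, shiftY x.toKIdx μ q.2) := rfl

omit [NormedAlgebra ℂ 𝔸] [CompleteSpace 𝔸] [Fintype ι] [DecidableEq ι] in
/-- `(bT T μ)⁻¹ (k, z) = (k, T_μ⁻¹ z)` (`rfl`). [cite: Balaban1985BackgroundPropagators, (3.3) p.390, dictionary] -/
theorem bT_symm_apply (μ : Fin (d + 1)) (q : Fin (d + 1) × SiteY x.toKIdx) :
    (bT (shiftY x.toKIdx) μ).symm q = (q.1, (shiftY x.toKIdx μ).symm q.2) := rfl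

/-- ★ **THE PLAQUETTE LAW OF A `G`-VALUED BASE FROM THE CLASS LAW (3.35) ON PLAQUETTES** (`Reg335PlaqY C₀ U ⟹ PlaqLawY (2C₀) U`): the ordered plaquettes
`μ < ν` through their own base point are the class law's, `μ > ν` is the inverse holonomy (same distance from `1` at unit norms), `μ = ν` is trivial.
[cite: Balaban1985BackgroundPropagators, (3.35) p.396, p.404 (after (3.69)), (3.5) p.391] -/
theorem plaqLawY_of_reg335PlaqY (hG1 : ∀ u : 𝔸ˣ, u ∈ G → ‖(u : 𝔸)‖ ≤ 1) {U : CfgY 𝔸 x.toKIdx} (hU : GVal G x.toKIdx U) {C₀ : ℝ} (hC₀ : 0 ≤ C₀)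
    (h : Reg335PlaqY G x ιB C₀ U) : PlaqLawY x ιB (2 * C₀) U := by
  have hco : coordC G x.toKIdx (.base U) = UboxY x.toKIdx U := coordC_base_eq G x hU
  have hρu : ∀ (κ' : Fin (d + 1)) (w : SiteY x.toKIdx), ‖((UboxY x.toKIdx U κ' w : 𝔸ˣ) : 𝔸)‖ ≤ 1 ∧ ‖(((UboxY x.toKIdx U κ' w)⁻¹ : 𝔸ˣ) : 𝔸)‖ ≤ 1 :=
    fun κ' w => norm_le_one_and_inv_of_mem G hG1 (hU κ' _ : UboxY x.toKIdx U κ' w ∈ G)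
  -- the scale of the class law is the `η/ℓ` of the plaquette law
  have hscale : ∀ z : SiteY x.toKIdx, (((geo9Y x).L ^ (geo9Y x).scale (blkC x.toKIdx ιB z))⁻¹) ^ 2 =
      ((kGeo x.toKIdx).eta * ((geo9Y x).len (blkC x.toKIdx ιB z))⁻¹) ^ 2 := fun z => by
    have hη : (geo9Y x).eta ≠ 0 := ne_of_gt (geo9K_eta_pos x.toKIdx)
    have e : (geo9Y x).eta * ((geo9Y x).L ^ (geo9Y x).scale (blkC x.toKIdx ιB z) * (geo9Y x).eta)⁻¹ =
        ((geo9Y x).L ^ (geo9Y x).scale (blkC x.toKIdx ιB z))⁻¹ := by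
      field_simp
    exact congrArg (fun t : ℝ => t ^ 2) e.symm
  -- the ordered plaquettes: the class law at the plaquette's own base point
  have hord : ∀ (μ ν : Fin (d + 1)) (z : SiteY x.toKIdx), μ < ν →
      ‖((plaqU (shiftY x.toKIdx) (UboxY x.toKIdx U) μ ν z : 𝔸ˣ) : 𝔸) - 1‖ ≤ C₀ * ((kGeo x.toKIdx).eta * ((geo9Y x).len (blkC x.toKIdx ιB z))⁻¹) ^ 2 := by
    intro μ ν z hμν
    have h1 := h μ z μ ν z (through_self (shiftY x.toKIdx) hμν z)
    rw [hco, hscale] at h1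
    exact h1
  refine plaqLawY_of_holonomy_bound G x ιB hG1 hU fun μ ν z => ?_
  show ‖((plaqU (shiftY x.toKIdx) (UboxY x.toKIdx U) μ ν z : 𝔸ˣ) : 𝔸) - 1‖ ≤ _
  have h0 : 0 ≤ C₀ * ((kGeo x.toKIdx).eta * ((geo9Y x).len (blkC x.toKIdx ιB z))⁻¹) ^ 2 := mul_nonneg hC₀ (sq_nonneg _)
  rcases lt_trichotomy μ ν with hμν | hμν | hμν
  · exact hord μ ν z hμν
  · subst hμν
    have : plaqU (shiftY x.toKIdx) (UboxY x.toKIdx U) μ μ z = 1 := by unfold plaqU; group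
    rw [this, Units.val_one, sub_self, norm_zero]; exact h0
  · -- the reversed plaquette is the inverse holonomy
    have hinv : plaqU (shiftY x.toKIdx) (UboxY x.toKIdx U) μ ν z = (plaqU (shiftY x.toKIdx) (UboxY x.toKIdx U) ν μ z)⁻¹ := by
      unfold plaqU; group
    set P := plaqU (shiftY x.toKIdx) (UboxY x.toKIdx U) ν μ z with hP
    have hmul : ∀ u v : 𝔸ˣ, ‖(u : 𝔸)‖ ≤ 1 → ‖(v : 𝔸)‖ ≤ 1 → ‖((u * v : 𝔸ˣ) : 𝔸)‖ ≤ 1 := fun u v hu hv => by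
      rw [Units.val_mul]; exact (norm_mul_le _ _).trans (mul_le_one₀ hu (norm_nonneg _) hv)
    have hP1 : ‖((plaqU (shiftY x.toKIdx) (UboxY x.toKIdx U) μ ν z : 𝔸ˣ) : 𝔸)‖ ≤ 1 := by
      unfold plaqU
      exact hmul _ _ (hmul _ _ (hmul _ _ (hρu _ _).1 (hρu _ _).1) (hρu _ _).2) (hρu _ _).2
    have hPn : ‖((P⁻¹ : 𝔸ˣ) : 𝔸)‖ ≤ 1 := by rw [hP, ← hinv]; exact hP1
    rw [hinv]
    have e1 : ((P⁻¹ : 𝔸ˣ) : 𝔸) - 1 = ((P⁻¹ : 𝔸ˣ) : 𝔸) * (1 - (P : 𝔸)) := by rw [mul_sub, mul_one, Units.inv_mul]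
    rw [e1]
    calc ‖((P⁻¹ : 𝔸ˣ) : 𝔸) * (1 - (P : 𝔸))‖ ≤ ‖((P⁻¹ : 𝔸ˣ) : 𝔸)‖ * ‖1 - ((P : 𝔸ˣ) : 𝔸)‖ := norm_mul_le _ _
      _ ≤ 1 * ‖1 - ((P : 𝔸ˣ) : 𝔸)‖ := mul_le_mul_of_nonneg_right hPn (norm_nonneg _)
      _ = ‖((P : 𝔸ˣ) : 𝔸) - 1‖ := by rw [one_mul, norm_sub_rev]
      _ ≤ _ := hord ν μ z hμν

end Facts

/-! ## §1  ★★ Every orientation of the six `L²` bond letters at a base -/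

section All

variable {Mstar : ℕ} (G : Subgroup 𝔸ˣ) (x : MemberY d ℓ hd hL b₀ b₁ Mstar) (parS : SiteParY 𝔸 x.toKIdx) (parB : BondParY 𝔸 x.toKIdx)
  (b : Module.Basis ι ℝ 𝔸) (ιB : BlkY x.toKIdx → IBondY x.toKIdx) (C37 C38 : ℝ → CfgY 𝔸 x.toKIdx → AfldY 𝔸 x.toKIdx → Prop)
  [Fintype (geo9Y x).Site] [DecidableEq (geo9Y x).Site]

set_option maxHeartbeats 1600000 in
/-- ★★ **FIELD `readGL2` OF `L2GFrame₇` AT NODE 00's LETTERS — EVERY ORIENTATION** (p. 398 first remark, made quantitative in block-`ℓ²`): at a member with a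
section `ιB` of `β`, unit-norm structure group, a real basis, [4] Lemma 2.1 at `(δ₀, 1/12)` (exponent `dL`), the scale transfers of `ℓ` and `ℓ⁻²` with one
constant `Λ ≧ 1`, and the plaquette law `PlaqLawY c_P U` of the `G`-valued base `U`: the (3.46) block of `KACU` at `base U` with `(B₀, δ₀)` gives, for ALL
`k, l ∈ κ ⊕ κ`, block-`ℓ²` majorants of `GbC`, `∇♯_k·GbC`, `GbC·∇♯_k`, `∇♯_k∇♯_l·GbC`, `∇♯_k·GbC·∇♯_l`, `GbC·∇♯_k∇♯_l` with `(cLGY·B₀, δ₀/2)`; letters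
`∇♯_k = conj b (diffLetter (bT shiftY) (bU (coordC (base U))) η⁻¹ k)`.
[cite: Balaban1985BackgroundPropagators, Thm 3.3 p.399 with (3.46) p.398, p.398 (first remark), (3.8) p.392, p.404 (after (3.69)); Balaban1984PropagatorsII, Prop. 2.6 (2.140)–(2.141) p.247, Lemma 2.1 p.234] -/
theorem readGL2_GbC_all [FiniteDimensional ℝ 𝔸] (hι : ∀ s, β x.toKIdx.hN x.toKIdx.D x.toKIdx.hk (ιB s) = s)
    (hG1 : ∀ u : 𝔸ˣ, u ∈ G → ‖(u : 𝔸)‖ ≤ 1) {M₂ : ℝ} (hM₂ : 0 ≤ M₂) (hrepr : ∀ (v : 𝔸) (j : ι), |b.repr v j| ≤ M₂ * ‖v‖)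
    {δ₀ : ℝ} (hδ₀ : 0 < δ₀) {dL : ℕ} (h261 : Ineq261 dL (toB6 (geo9Y x) (0 : ℝ) True) δ₀ (1 / 12)) {Λ : ℝ} (hΛ : 1 ≤ Λ)
    (hT1 : ScaleTransfer (geo9Y x) δ₀ (1 / 12) Λ (fun a => (geo9Y x).len a))
    (hTi2 : ScaleTransfer (geo9Y x) δ₀ (1 / 12) Λ (fun a => ((geo9Y x).len a)⁻¹ ^ 2))
    {cP : ℝ} (hcP : 0 ≤ cP) {U : CfgY 𝔸 x.toKIdx} (hUG : GVal G x.toKIdx U) (hplaq : PlaqLawY x ιB cP U)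
    {B₀ : ℝ} (hB₀ : 0 ≤ B₀) (hL2 : L2Block (KACU G x (GAY x.toKIdx parS parB (GpY x.toKIdx parS)) parB C37 C38) B₀ δ₀ (.base U)) :
    HasL2Majorant (g := toB6 (geo9Y x) (0 : ℝ) True) (fun q : (Fin (d + 1) × SiteY x.toKIdx) × ι => blkC x.toKIdx ιB q.1.2) (GbC x.toKIdx parS parB b (.base U)) (fun a a' => cLGY cP M₂ (∑ j, ‖b j‖) (Real.sqrt (Fintype.card ι)) d dL δ₀ Λ * B₀ * (geo9Y x).len a ^ 2 * Real.exp (-(δ₀ / 2 * (geo9Y x).dist a a'))) ∧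
      (∀ k : Fin (d + 1) ⊕ Fin (d + 1), HasL2Majorant (g := toB6 (geo9Y x) (0 : ℝ) True) (fun q : (Fin (d + 1) × SiteY x.toKIdx) × ι => blkC x.toKIdx ιB q.1.2)
        (conj b (diffLetter (bT (shiftY x.toKIdx)) (bU (coordC G x.toKIdx (.base U))) (((((geo9Y x).eta : ℂ)))⁻¹) (k)) * GbC x.toKIdx parS parB b (.base U)) (fun a a' => cLGY cP M₂ (∑ j, ‖b j‖) (Real.sqrt (Fintype.card ι)) d dL δ₀ Λ * B₀ * (geo9Y x).len a * Real.exp (-(δ₀ / 2 * (geo9Y x).dist a a')))) ∧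
      (∀ k : Fin (d + 1) ⊕ Fin (d + 1), HasL2Majorant (g := toB6 (geo9Y x) (0 : ℝ) True) (fun q : (Fin (d + 1) × SiteY x.toKIdx) × ι => blkC x.toKIdx ιB q.1.2)
        (GbC x.toKIdx parS parB b (.base U) * conj b (diffLetter (bT (shiftY x.toKIdx)) (bU (coordC G x.toKIdx (.base U))) (((((geo9Y x).eta : ℂ)))⁻¹) (k))) (fun a a' => cLGY cP M₂ (∑ j, ‖b j‖) (Real.sqrt (Fintype.card ι)) d dL δ₀ Λ * B₀ * (geo9Y x).len a * Real.exp (-(δ₀ / 2 * (geo9Y x).dist a a')))) ∧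
      (∀ k l : Fin (d + 1) ⊕ Fin (d + 1), HasL2Majorant (g := toB6 (geo9Y x) (0 : ℝ) True) (fun q : (Fin (d + 1) × SiteY x.toKIdx) × ι => blkC x.toKIdx ιB q.1.2)
        (conj b (diffLetter (bT (shiftY x.toKIdx)) (bU (coordC G x.toKIdx (.base U))) (((((geo9Y x).eta : ℂ)))⁻¹) (k)) *
          conj b (diffLetter (bT (shiftY x.toKIdx)) (bU (coordC G x.toKIdx (.base U))) (((((geo9Y x).eta : ℂ)))⁻¹) (l)) * GbC x.toKIdx parS parB b (.base U)) (fun a a' => cLGY cP M₂ (∑ j, ‖b j‖) (Real.sqrt (Fintype.card ι)) d dL δ₀ Λ * B₀ * 1 * Real.exp (-(δ₀ / 2 * (geo9Y x).dist a a')))) ∧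
      (∀ k l : Fin (d + 1) ⊕ Fin (d + 1), HasL2Majorant (g := toB6 (geo9Y x) (0 : ℝ) True) (fun q : (Fin (d + 1) × SiteY x.toKIdx) × ι => blkC x.toKIdx ιB q.1.2)
        (conj b (diffLetter (bT (shiftY x.toKIdx)) (bU (coordC G x.toKIdx (.base U))) (((((geo9Y x).eta : ℂ)))⁻¹) (k)) * GbC x.toKIdx parS parB b (.base U) *
          conj b (diffLetter (bT (shiftY x.toKIdx)) (bU (coordC G x.toKIdx (.base U))) (((((geo9Y x).eta : ℂ)))⁻¹) (l))) (fun a a' => cLGY cP M₂ (∑ j, ‖b j‖) (Real.sqrt (Fintype.card ι)) d dL δ₀ Λ * B₀ * 1 * Real.exp (-(δ₀ / 2 * (geo9Y x).dist a a')))) ∧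
      (∀ k l : Fin (d + 1) ⊕ Fin (d + 1), HasL2Majorant (g := toB6 (geo9Y x) (0 : ℝ) True) (fun q : (Fin (d + 1) × SiteY x.toKIdx) × ι => blkC x.toKIdx ιB q.1.2)
        (GbC x.toKIdx parS parB b (.base U) * conj b (diffLetter (bT (shiftY x.toKIdx)) (bU (coordC G x.toKIdx (.base U))) (((((geo9Y x).eta : ℂ)))⁻¹) (k)) *
          conj b (diffLetter (bT (shiftY x.toKIdx)) (bU (coordC G x.toKIdx (.base U))) (((((geo9Y x).eta : ℂ)))⁻¹) (l))) (fun a a' => cLGY cP M₂ (∑ j, ‖b j‖) (Real.sqrt (Fintype.card ι)) d dL δ₀ Λ * B₀ * 1 * Real.exp (-(δ₀ / 2 * (geo9Y x).dist a a')))) := by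
  -- constants and geometry
  set η : ℝ := (kGeo x.toKIdx).eta with hηdef
  have hη0 : 0 < η := geo9K_eta_pos x.toKIdx
  set Sb : ℝ := ∑ j, ‖b j‖ with hSbdef
  set sι : ℝ := Real.sqrt (Fintype.card ι) with hsι
  set cL : ℝ := sι * M₂ * Sb with hcL
  set Bin : ℝ := cL * B₀ with hBin
  set c₁ : ℝ := B6.c1 dL δ₀ (1 / 12) with hc₁
  set d₀ : ℝ := 2 * ((d : ℝ) + 1) with hd₀
  set σ₁ : ℝ := Λ * Real.exp (1 / 12 * δ₀ * d₀) with hσ₁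
  set gX : ℝ := 1 + ((1 : ℝ) ^ 2 * M₂ * Sb * sι * Real.exp (δ₀ * d₀)) * Λ * c₁ with hgX
  set gI : ℝ := 1 + c₁ * M₂ * Sb * sι * ((1 : ℝ) ^ 2 * Real.exp (δ₀ * d₀) * Λ + (1 : ℝ) ^ 4 * cP * σ₁ * Real.exp (δ₀ * (2 * d₀)) * Λ) with hgI
  set Bx : ℝ := cLGY cP M₂ (∑ j, ‖b j‖) (Real.sqrt (Fintype.card ι)) d dL δ₀ Λ * B₀ with hBxdef
  have hSb : 0 ≤ Sb := Finset.sum_nonneg fun i _ => norm_nonneg _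
  have hsι0 : 0 ≤ sι := Real.sqrt_nonneg _
  have hcL0 : 0 ≤ cL := by positivity
  have hBin0 : 0 ≤ Bin := mul_nonneg hcL0 hB₀
  have hΛ0 : 0 ≤ Λ := le_trans zero_le_one hΛ
  have hc₁0 : 0 ≤ c₁ := B6RandomWalk.c1_nonneg dL δ₀ (1 / 12)
  have hσ₁0 : 0 ≤ σ₁ := by positivity
  have hgX1 : 1 ≤ gX := by rw [hgX]; exact le_add_of_nonneg_right (by positivity)
  have hgX0 : 0 ≤ gX := le_trans zero_le_one hgX1
  have hgI1 : 1 ≤ gI := by rw [hgI]; exact le_add_of_nonneg_right (by positivity)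
  have hgI0 : 0 ≤ gI := le_trans zero_le_one hgI1
  have hBx : Bx = gX ^ 2 * gI * Bin := by
    simp only [hBxdef, cLGY, hgX, hgI, hσ₁, hBin, hcL, hc₁, hd₀, hSbdef, hsι]; ring
  have hdnn : ∀ y y' : (geo9Y x).Site, 0 ≤ (geo9Y x).dist y y' := geo9Y_dist_nonneg x
  have htri : Triangle254 (toB6 (geo9Y x) (0 : ℝ) True) := fun p q r => geo9Y_dist_triangle x p q r
  have hlen : ∀ y : (geo9Y x).Site, 0 < (geo9Y x).len y := geo9Y_len_pos x
  have hwℓ : ∀ p : (geo9Y x).Site, 0 ≤ (geo9Y x).len p := fun p => (hlen p).le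
  have hd₀F : ∀ (μ : Fin (d + 1)) (q : Fin (d + 1) × SiteY x.toKIdx),
      (geo9Y x).dist (blkC x.toKIdx ιB q.2) (blkC x.toKIdx ιB ((bT (shiftY x.toKIdx)) μ q).2) ≤ d₀ := fun μ q => stencilF_blkC x.toKIdx ιB hι μ q.2
  have hd₀B : ∀ (μ : Fin (d + 1)) (q : Fin (d + 1) × SiteY x.toKIdx),
      (geo9Y x).dist (blkC x.toKIdx ιB q.2) (blkC x.toKIdx ιB (((bT (shiftY x.toKIdx)) μ).symm q).2) ≤ d₀ := fun μ q => stencilB_blkC x.toKIdx ιB hι μ q.2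
  have hd₀FB : ∀ (μ : Fin (d + 1)) (q : Fin (d + 1) × SiteY x.toKIdx),
      (geo9Y x).dist (blkC x.toKIdx ιB q.2) (blkC x.toKIdx ιB ((bT (shiftY x.toKIdx)) μ q).2) ≤ d₀ ∧
      (geo9Y x).dist (blkC x.toKIdx ιB q.2) (blkC x.toKIdx ιB (((bT (shiftY x.toKIdx)) μ).symm q).2) ≤ d₀ := fun μ q => ⟨hd₀F μ q, hd₀B μ q⟩
  have hρu : ∀ (μ : Fin (d + 1)) (q : Fin (d + 1) × SiteY x.toKIdx), ‖(((bU (UboxY x.toKIdx U)) μ q : 𝔸ˣ) : 𝔸)‖ ≤ 1 ∧ ‖((((bU (UboxY x.toKIdx U)) μ q)⁻¹ : 𝔸ˣ) : 𝔸)‖ ≤ 1 :=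
    fun μ q => norm_le_one_and_inv_of_mem G hG1 (hUG μ _ : UboxY x.toKIdx U μ q.2 ∈ G)
  have hαδ : 0 ≤ 1 / 12 * δ₀ := by positivity
  have hT0 : ScaleTransfer (geo9Y x) δ₀ (1 / 12) Λ (fun _ => (1 : ℝ)) := fun y y' => by
    rw [mul_one, mul_one]
    have : Real.exp (-(1 / 12 * δ₀ * (geo9Y x).dist y y')) ≤ 1 := Real.exp_le_one_iff.2 (by nlinarith [hdnn y y', hδ₀.le])
    exact this.trans hΛ
  have heta : ∀ y : (geo9Y x).Site, η ≤ (geo9Y x).len y := B9SectBL2SecondOrderY.eta_le_len x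
  have hcomm : ∀ (μ ν : Fin (d + 1)) (q : Fin (d + 1) × SiteY x.toKIdx), (bT (shiftY x.toKIdx)) μ ((bT (shiftY x.toKIdx)) ν q) = (bT (shiftY x.toKIdx)) ν ((bT (shiftY x.toKIdx)) μ q) :=
    fun μ ν q => Prod.ext rfl (shiftY_comm x μ ν q.2)
  have hσ : ∀ (ν : Fin (d + 1)) (q : Fin (d + 1) × SiteY x.toKIdx), ((geo9Y x).len (blkC x.toKIdx ιB (((bT (shiftY x.toKIdx)) ν).symm q).2))⁻¹ ^ 2
      ≤ σ₁ * ((geo9Y x).len (blkC x.toKIdx ιB q.2))⁻¹ ^ 2 := fun ν q =>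
    le_of_scaleTransfer (w := fun a => ((geo9Y x).len a)⁻¹ ^ 2) hTi2 hαδ (hd₀B ν q) (pow_nonneg (inv_nonneg.mpr (hlen _).le) _)
  have hplaq' : ∀ (μ ν : Fin (d + 1)) (q : Fin (d + 1) × SiteY x.toKIdx) (X : 𝔸),
      ‖R ((bU (UboxY x.toKIdx U)) μ q * (bU (UboxY x.toKIdx U)) ν ((bT (shiftY x.toKIdx)) μ q)) X - R ((bU (UboxY x.toKIdx U)) ν q * (bU (UboxY x.toKIdx U)) μ ((bT (shiftY x.toKIdx)) ν q)) X‖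
        ≤ cP * (η * ((geo9Y x).len (blkC x.toKIdx ιB q.2))⁻¹) ^ 2 * ‖X‖ := fun μ ν q X => hplaq μ ν q.2 X
  -- the letters: `D k` at the genuine `U_□` (the frame's `coordC (base U)` IS `U_□` at a `G`-valued base)
  have hco : coordC G x.toKIdx (.base U) = UboxY x.toKIdx U := coordC_base_eq G x hUG
  set Gb := GbC x.toKIdx parS parB b (.base U) with hGb
  set D : Fin (d + 1) ⊕ Fin (d + 1) → Module.End ℝ ((Fin (d + 1) × SiteY x.toKIdx) → 𝔸) :=
    fun k => diffLetter (bT (shiftY x.toKIdx)) (bU (UboxY x.toKIdx U)) (((η : ℂ))⁻¹) k with hD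
  have hDc : ∀ k, conj b (diffLetter (bT (shiftY x.toKIdx)) (bU (coordC G x.toKIdx (.base U))) (((((geo9Y x).eta : ℂ)))⁻¹) (k)) = conj b (D k) := fun k => by
    rw [hco]; rfl
  simp only [hDc]
  -- READ print's orientations (gen 14's `readGL2_GbC_printed`), rate δ₀, constant Bin
  obtain ⟨r0, r1', r2', r4', r3', r5'⟩ := readGL2_GbC_printed (Rr := (0 : ℝ)) (Hp := True) G x parS parB b ιB C37 C38 hι hM₂ hrepr U hUG hB₀ hL2
  simp only [hDc] at r1' r2' r3' r4' r5'
  have hK : ∀ (w : (geo9Y x).Site → ℝ) (p q : (geo9Y x).Site), (Real.sqrt (Fintype.card ι) * M₂ * ∑ j, ‖b j‖) * B₀ * w p * Real.exp (-(δ₀ * (geo9Y x).dist p q))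
      = Bin * w p * Real.exp (-(δ₀ * (geo9Y x).dist p q)) := fun w p q => by rw [hBin, hcL, hsι, hSbdef]
  have r0' : HasL2Majorant (g := toB6 (geo9Y x) (0 : ℝ) True) (fun q : (Fin (d + 1) × SiteY x.toKIdx) × ι => blkC x.toKIdx ιB q.1.2) Gb (fun p q => Bin * (geo9Y x).len p ^ 2 * Real.exp (-(δ₀ * (geo9Y x).dist p q))) :=
    hasL2Majorant_mono (g := toB6 (geo9Y x) (0 : ℝ) True) _ r0 fun p q => le_of_eq (hK (fun p => (geo9Y x).len p ^ 2) p q)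
  have r1 : ∀ μ, HasL2Majorant (g := toB6 (geo9Y x) (0 : ℝ) True) (fun q : (Fin (d + 1) × SiteY x.toKIdx) × ι => blkC x.toKIdx ιB q.1.2) (conj b (D (Sum.inl μ)) * Gb) (fun p q => Bin * (geo9Y x).len p * Real.exp (-(δ₀ * (geo9Y x).dist p q))) := fun μ =>
    hasL2Majorant_mono (g := toB6 (geo9Y x) (0 : ℝ) True) _ (r1' μ) fun p q => le_of_eq (hK (fun p => (geo9Y x).len p) p q)
  have r2 : ∀ μ, HasL2Majorant (g := toB6 (geo9Y x) (0 : ℝ) True) (fun q : (Fin (d + 1) × SiteY x.toKIdx) × ι => blkC x.toKIdx ιB q.1.2) (Gb * conj b (D (Sum.inr μ))) (fun p q => Bin * (geo9Y x).len p * Real.exp (-(δ₀ * (geo9Y x).dist p q))) := fun μ =>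
    hasL2Majorant_mono (g := toB6 (geo9Y x) (0 : ℝ) True) _ (r2' μ) fun p q => le_of_eq (hK (fun p => (geo9Y x).len p) p q)
  have r3 : ∀ μ ν, HasL2Majorant (g := toB6 (geo9Y x) (0 : ℝ) True) (fun q : (Fin (d + 1) × SiteY x.toKIdx) × ι => blkC x.toKIdx ιB q.1.2) (conj b (D (Sum.inl μ)) * conj b (D (Sum.inl ν)) * Gb) (fun p q => Bin * 1 * Real.exp (-(δ₀ * (geo9Y x).dist p q))) := fun μ ν =>
    hasL2Majorant_mono (g := toB6 (geo9Y x) (0 : ℝ) True) _ (r3' μ ν) fun p q => le_of_eq (hK (fun _ => 1) p q)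
  have r4 : ∀ μ ν, HasL2Majorant (g := toB6 (geo9Y x) (0 : ℝ) True) (fun q : (Fin (d + 1) × SiteY x.toKIdx) × ι => blkC x.toKIdx ιB q.1.2) (conj b (D (Sum.inl μ)) * Gb * conj b (D (Sum.inr ν))) (fun p q => Bin * 1 * Real.exp (-(δ₀ * (geo9Y x).dist p q))) := fun μ ν =>
    hasL2Majorant_mono (g := toB6 (geo9Y x) (0 : ℝ) True) _ (r4' μ ν) fun p q => le_of_eq (hK (fun _ => 1) p q)
  have r5 : ∀ μ ν, HasL2Majorant (g := toB6 (geo9Y x) (0 : ℝ) True) (fun q : (Fin (d + 1) × SiteY x.toKIdx) × ι => blkC x.toKIdx ιB q.1.2) (Gb * conj b (D (Sum.inr μ)) * conj b (D (Sum.inr ν))) (fun p q => Bin * 1 * Real.exp (-(δ₀ * (geo9Y x).dist p q))) := fun μ ν =>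
    hasL2Majorant_mono (g := toB6 (geo9Y x) (0 : ℝ) True) _ (r5' μ ν) fun p q => le_of_eq (hK (fun _ => 1) p q)
  -- rates
  set ρ₁ : ℝ := 5 * δ₀ / 6 with hρ₁
  set ρ₂ : ℝ := 2 * δ₀ / 3 with hρ₂
  have hρ₁0 : 0 ≤ ρ₁ := by rw [hρ₁]; positivity
  have hρ₂0 : 0 ≤ ρ₂ := by rw [hρ₂]; positivity
  have hr₁ : ρ₁ + (1 / 12 + 1 / 12) * δ₀ ≤ δ₀ := by rw [hρ₁]; linarith
  have hρ₁δ : ρ₁ ≤ δ₀ := by rw [hρ₁]; linarith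
  have hr₂ : ρ₂ + (1 / 12 + 1 / 12) * δ₀ ≤ ρ₁ := by rw [hρ₁, hρ₂]; linarith
  have hρ₂₁ : ρ₂ ≤ ρ₁ := by rw [hρ₁, hρ₂]; linarith
  -- the outer and inner step constants are bounded by `g_X`, `g_I` times the input constant (rates `≦ δ₀`)
  have hexp1 : ∀ r : ℝ, r ≤ δ₀ → Real.exp (r * d₀) ≤ Real.exp (δ₀ * d₀) := fun r hr =>
    Real.exp_le_exp.2 (mul_le_mul_of_nonneg_right hr (by rw [hd₀]; positivity))
  have hexp2 : ∀ r : ℝ, r ≤ δ₀ → Real.exp (r * (2 * d₀)) ≤ Real.exp (δ₀ * (2 * d₀)) := fun r hr =>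
    Real.exp_le_exp.2 (mul_le_mul_of_nonneg_right hr (by rw [hd₀]; positivity))
  have hstep : ∀ (r Bc : ℝ), r ≤ δ₀ → 0 ≤ Bc →
      (1 : ℝ) ^ 2 * M₂ * (∑ i, ‖b i‖) * Real.sqrt (Fintype.card ι) * Real.exp (r * d₀) * Λ * B6.c1 dL δ₀ (1 / 12) * Bc ≤ gX * Bc := by
    intro r Bc hr hBc
    have h1 : (1 : ℝ) ^ 2 * M₂ * (∑ i, ‖b i‖) * Real.sqrt (Fintype.card ι) * Real.exp (r * d₀) * Λ * B6.c1 dL δ₀ (1 / 12)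
        ≤ (1 : ℝ) ^ 2 * M₂ * Sb * sι * Real.exp (δ₀ * d₀) * Λ * c₁ := by
      rw [← hSbdef, ← hsι, ← hc₁]
      exact mul_le_mul_of_nonneg_right (mul_le_mul_of_nonneg_right (mul_le_mul_of_nonneg_left (hexp1 r hr) (by positivity)) hΛ0) hc₁0
    have h2 : (1 : ℝ) ^ 2 * M₂ * Sb * sι * Real.exp (δ₀ * d₀) * Λ * c₁ ≤ gX := by rw [hgX]; linarith
    exact mul_le_mul_of_nonneg_right (h1.trans h2) hBc
  have hstepI : ∀ (r Bc : ℝ), r ≤ δ₀ → 0 ≤ Bc →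
      (B6.c1 dL δ₀ (1 / 12) * M₂ * (∑ i, ‖b i‖) * Real.sqrt (Fintype.card ι)
        * ((1 : ℝ) ^ 2 * Real.exp (r * d₀) * Λ + (1 : ℝ) ^ 4 * cP * σ₁ * Real.exp (r * (2 * d₀)) * Λ)) * Bc ≤ gI * Bc := by
    intro r Bc hr hBc
    refine mul_le_mul_of_nonneg_right ?_ hBc
    rw [← hSbdef, ← hsι, ← hc₁, hgI]
    have hin : (1 : ℝ) ^ 2 * Real.exp (r * d₀) * Λ + (1 : ℝ) ^ 4 * cP * σ₁ * Real.exp (r * (2 * d₀)) * Λ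
        ≤ (1 : ℝ) ^ 2 * Real.exp (δ₀ * d₀) * Λ + (1 : ℝ) ^ 4 * cP * σ₁ * Real.exp (δ₀ * (2 * d₀)) * Λ :=
      add_le_add (mul_le_mul_of_nonneg_right (mul_le_mul_of_nonneg_left (hexp1 r hr) (by positivity)) hΛ0)
        (mul_le_mul_of_nonneg_right (mul_le_mul_of_nonneg_left (hexp2 r hr) (by positivity)) hΛ0)
    have h0 : 0 ≤ c₁ * M₂ * Sb * sι := by positivity
    have := mul_le_mul_of_nonneg_left hin h0
    linarith
  -- FIRST ORDER: the two cross conversions (rate ρ₁)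
  have x1 : ∀ μ, HasL2Majorant (g := toB6 (geo9Y x) (0 : ℝ) True) (fun q : (Fin (d + 1) × SiteY x.toKIdx) × ι => blkC x.toKIdx ιB q.1.2) (conj b (D (Sum.inr μ)) * Gb) (fun p q => (gX * Bin) * (geo9Y x).len p * Real.exp (-(ρ₁ * (geo9Y x).dist p q))) := fun μ => by
    have h := hasL2Majorant_cross_left b (bT (shiftY x.toKIdx)) (bU (UboxY x.toKIdx U)) (Rr := (0 : ℝ)) (H := True) (g := geo9Y x) (fun q : Fin (d + 1) × SiteY x.toKIdx => blkC x.toKIdx ιB q.2) dL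
      (((η : ℂ))⁻¹) 1 d₀ M₂ δ₀ δ₀ (1 / 12) (1 / 12) ρ₁ Λ Bin (fun p => (geo9Y x).len p) hwℓ hδ₀.le hM₂ hBin0 hΛ0 hρ₁0 hr₁ hρ₁δ hrepr hdnn htri h261 hT1
      hρu hd₀B μ (Gp := Gb) (r1 μ)
    exact hasL2Majorant_mono (g := toB6 (geo9Y x) (0 : ℝ) True) _ h fun p q =>
      mul_le_mul_of_nonneg_right (mul_le_mul_of_nonneg_right (hstep δ₀ Bin le_rfl hBin0) (hwℓ p)) (Real.exp_nonneg _)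
  have x2 : ∀ μ, HasL2Majorant (g := toB6 (geo9Y x) (0 : ℝ) True) (fun q : (Fin (d + 1) × SiteY x.toKIdx) × ι => blkC x.toKIdx ιB q.1.2) (Gb * conj b (D (Sum.inl μ))) (fun p q => (gX * Bin) * (geo9Y x).len p * Real.exp (-(ρ₁ * (geo9Y x).dist p q))) := fun μ => by
    have h := hasL2Majorant_cross_right b (bT (shiftY x.toKIdx)) (bU (UboxY x.toKIdx U)) (Rr := (0 : ℝ)) (H := True) (g := geo9Y x) (fun q : Fin (d + 1) × SiteY x.toKIdx => blkC x.toKIdx ιB q.2) dL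
      (((η : ℂ))⁻¹) 1 d₀ M₂ δ₀ δ₀ (1 / 12) (1 / 12) ρ₁ Λ Bin (fun p => (geo9Y x).len p) hwℓ hM₂ hBin0 hΛ hρ₁0 hr₁ hαδ hrepr hdnn htri h261
      hρu hd₀F μ (Gp := Gb) (r2 μ)
    exact hasL2Majorant_mono (g := toB6 (geo9Y x) (0 : ℝ) True) _ h fun p q =>
      mul_le_mul_of_nonneg_right (mul_le_mul_of_nonneg_right (hstep ρ₁ Bin hρ₁δ hBin0) (hwℓ p)) (Real.exp_nonneg _)
  -- MIXED words `D k * Gb * D l`: (inl, inr) read; (inr, inr) left cross; (inl, inl) right cross; (inr, inl) both (rate ρ₂)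
  have m_rr : ∀ μ ν, HasL2Majorant (g := toB6 (geo9Y x) (0 : ℝ) True) (fun q : (Fin (d + 1) × SiteY x.toKIdx) × ι => blkC x.toKIdx ιB q.1.2) (conj b (D (Sum.inr μ)) * (Gb * conj b (D (Sum.inr ν)))) (fun p q => (gX * Bin) * 1 * Real.exp (-(ρ₁ * (geo9Y x).dist p q))) :=
    fun μ ν => by
    have hin : HasL2Majorant (g := toB6 (geo9Y x) (0 : ℝ) True) (fun q : (Fin (d + 1) × SiteY x.toKIdx) × ι => blkC x.toKIdx ιB q.1.2) (conj b (D (Sum.inl μ)) * (Gb * conj b (D (Sum.inr ν)))) (fun p q => Bin * 1 * Real.exp (-(δ₀ * (geo9Y x).dist p q))) := by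
      rw [← mul_assoc]; exact r4 μ ν
    have h := hasL2Majorant_cross_left b (bT (shiftY x.toKIdx)) (bU (UboxY x.toKIdx U)) (Rr := (0 : ℝ)) (H := True) (g := geo9Y x) (fun q : Fin (d + 1) × SiteY x.toKIdx => blkC x.toKIdx ιB q.2) dL
      (((η : ℂ))⁻¹) 1 d₀ M₂ δ₀ δ₀ (1 / 12) (1 / 12) ρ₁ Λ Bin (fun _ => (1 : ℝ)) (fun _ => zero_le_one) hδ₀.le hM₂ hBin0 hΛ0 hρ₁0 hr₁ hρ₁δ hrepr hdnn htri
      h261 hT0 hρu hd₀B μ (Gp := Gb * conj b (D (Sum.inr ν))) hin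
    exact hasL2Majorant_mono (g := toB6 (geo9Y x) (0 : ℝ) True) _ h fun p q =>
      mul_le_mul_of_nonneg_right (mul_le_mul_of_nonneg_right (hstep δ₀ Bin le_rfl hBin0) zero_le_one) (Real.exp_nonneg _)
  have m_ll : ∀ μ ν, HasL2Majorant (g := toB6 (geo9Y x) (0 : ℝ) True) (fun q : (Fin (d + 1) × SiteY x.toKIdx) × ι => blkC x.toKIdx ιB q.1.2) (conj b (D (Sum.inl μ)) * Gb * conj b (D (Sum.inl ν))) (fun p q => (gX * Bin) * 1 * Real.exp (-(ρ₁ * (geo9Y x).dist p q))) :=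
    fun μ ν => by
    have h := hasL2Majorant_cross_right b (bT (shiftY x.toKIdx)) (bU (UboxY x.toKIdx U)) (Rr := (0 : ℝ)) (H := True) (g := geo9Y x) (fun q : Fin (d + 1) × SiteY x.toKIdx => blkC x.toKIdx ιB q.2) dL
      (((η : ℂ))⁻¹) 1 d₀ M₂ δ₀ δ₀ (1 / 12) (1 / 12) ρ₁ Λ Bin (fun _ => (1 : ℝ)) (fun _ => zero_le_one) hM₂ hBin0 hΛ hρ₁0 hr₁ hαδ hrepr hdnn htri h261
      hρu hd₀F ν (Gp := conj b (D (Sum.inl μ)) * Gb) (r4 μ ν)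
    exact hasL2Majorant_mono (g := toB6 (geo9Y x) (0 : ℝ) True) _ h fun p q =>
      mul_le_mul_of_nonneg_right (mul_le_mul_of_nonneg_right (hstep ρ₁ Bin hρ₁δ hBin0) zero_le_one) (Real.exp_nonneg _)
  have m_rl : ∀ μ ν, HasL2Majorant (g := toB6 (geo9Y x) (0 : ℝ) True) (fun q : (Fin (d + 1) × SiteY x.toKIdx) × ι => blkC x.toKIdx ιB q.1.2) (conj b (D (Sum.inr μ)) * (Gb * conj b (D (Sum.inl ν)))) (fun p q => (gX * (gX * Bin)) * 1 * Real.exp (-(ρ₂ * (geo9Y x).dist p q))) :=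
    fun μ ν => by
    have hin : HasL2Majorant (g := toB6 (geo9Y x) (0 : ℝ) True) (fun q : (Fin (d + 1) × SiteY x.toKIdx) × ι => blkC x.toKIdx ιB q.1.2) (conj b (D (Sum.inl μ)) * (Gb * conj b (D (Sum.inl ν)))) (fun p q => (gX * Bin) * 1 * Real.exp (-(ρ₁ * (geo9Y x).dist p q))) := by
      rw [← mul_assoc]; exact m_ll μ ν
    have h := hasL2Majorant_cross_left b (bT (shiftY x.toKIdx)) (bU (UboxY x.toKIdx U)) (Rr := (0 : ℝ)) (H := True) (g := geo9Y x) (fun q : Fin (d + 1) × SiteY x.toKIdx => blkC x.toKIdx ιB q.2) dL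
      (((η : ℂ))⁻¹) 1 d₀ M₂ δ₀ ρ₁ (1 / 12) (1 / 12) ρ₂ Λ (gX * Bin) (fun _ => (1 : ℝ)) (fun _ => zero_le_one) hρ₁0 hM₂ (mul_nonneg hgX0 hBin0) hΛ0 hρ₂0 hr₂
      hρ₂₁ hrepr hdnn htri h261 hT0 hρu hd₀B μ (Gp := Gb * conj b (D (Sum.inl ν))) hin
    exact hasL2Majorant_mono (g := toB6 (geo9Y x) (0 : ℝ) True) _ h fun p q =>
      mul_le_mul_of_nonneg_right (mul_le_mul_of_nonneg_right (hstep ρ₁ (gX * Bin) hρ₁δ (mul_nonneg hgX0 hBin0)) zero_le_one) (Real.exp_nonneg _)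
  -- SECOND ORDER LEFT `D k * D l * Gb`: inner switch (inl, inr) at ρ₁; outer (inr, inl) at ρ₁ and (inr, inr) at ρ₂
  have w3_li : ∀ μ ν, HasL2Majorant (g := toB6 (geo9Y x) (0 : ℝ) True) (fun q : (Fin (d + 1) × SiteY x.toKIdx) × ι => blkC x.toKIdx ιB q.1.2) (conj b (D (Sum.inl μ)) * conj b (D (Sum.inr ν)) * Gb) (fun p q => (gI * Bin) * 1 * Real.exp (-(ρ₁ * (geo9Y x).dist p q))) :=
    fun μ ν => by
    have h := hasL2Majorant_cross2_left_inner b (bT (shiftY x.toKIdx)) (bU (UboxY x.toKIdx U)) (Rr := (0 : ℝ)) (H := True) (g := geo9Y x)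
      (fun q : Fin (d + 1) × SiteY x.toKIdx => blkC x.toKIdx ιB q.2) dL hη0 1 cP σ₁ d₀ M₂ δ₀ δ₀ (1 / 12) (1 / 12) ρ₁ Λ Λ Bin hcP hσ₁0 hδ₀.le hM₂ hBin0 hΛ0 hΛ0 hρ₁0 hr₁ hρ₁δ hrepr hdnn
      htri hlen h261 hT0 hT1 μ ν (hcomm μ ν) hρu (hplaq' μ ν) hd₀FB (hσ ν) heta (Gp := Gb) (r3 μ ν) (r1 ν)
    exact hasL2Majorant_mono (g := toB6 (geo9Y x) (0 : ℝ) True) _ h fun p q =>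
      mul_le_mul_of_nonneg_right (mul_le_mul_of_nonneg_right (hstepI δ₀ Bin le_rfl hBin0) zero_le_one) (Real.exp_nonneg _)
  have w3_rl : ∀ μ ν, HasL2Majorant (g := toB6 (geo9Y x) (0 : ℝ) True) (fun q : (Fin (d + 1) × SiteY x.toKIdx) × ι => blkC x.toKIdx ιB q.1.2) (conj b (D (Sum.inr μ)) * (conj b (D (Sum.inl ν)) * Gb)) (fun p q => (gX * Bin) * 1 * Real.exp (-(ρ₁ * (geo9Y x).dist p q))) :=
    fun μ ν => by
    have hin : HasL2Majorant (g := toB6 (geo9Y x) (0 : ℝ) True) (fun q : (Fin (d + 1) × SiteY x.toKIdx) × ι => blkC x.toKIdx ιB q.1.2) (conj b (D (Sum.inl μ)) * (conj b (D (Sum.inl ν)) * Gb)) (fun p q => Bin * 1 * Real.exp (-(δ₀ * (geo9Y x).dist p q))) := by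
      rw [← mul_assoc]; exact r3 μ ν
    have h := hasL2Majorant_cross_left b (bT (shiftY x.toKIdx)) (bU (UboxY x.toKIdx U)) (Rr := (0 : ℝ)) (H := True) (g := geo9Y x) (fun q : Fin (d + 1) × SiteY x.toKIdx => blkC x.toKIdx ιB q.2) dL
      (((η : ℂ))⁻¹) 1 d₀ M₂ δ₀ δ₀ (1 / 12) (1 / 12) ρ₁ Λ Bin (fun _ => (1 : ℝ)) (fun _ => zero_le_one) hδ₀.le hM₂ hBin0 hΛ0 hρ₁0 hr₁ hρ₁δ hrepr hdnn htri
      h261 hT0 hρu hd₀B μ (Gp := conj b (D (Sum.inl ν)) * Gb) hin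
    exact hasL2Majorant_mono (g := toB6 (geo9Y x) (0 : ℝ) True) _ h fun p q =>
      mul_le_mul_of_nonneg_right (mul_le_mul_of_nonneg_right (hstep δ₀ Bin le_rfl hBin0) zero_le_one) (Real.exp_nonneg _)
  have w3_rr : ∀ μ ν, HasL2Majorant (g := toB6 (geo9Y x) (0 : ℝ) True) (fun q : (Fin (d + 1) × SiteY x.toKIdx) × ι => blkC x.toKIdx ιB q.1.2) (conj b (D (Sum.inr μ)) * (conj b (D (Sum.inr ν)) * Gb)) (fun p q => (gX * (gI * Bin)) * 1 * Real.exp (-(ρ₂ * (geo9Y x).dist p q))) :=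
    fun μ ν => by
    have hin : HasL2Majorant (g := toB6 (geo9Y x) (0 : ℝ) True) (fun q : (Fin (d + 1) × SiteY x.toKIdx) × ι => blkC x.toKIdx ιB q.1.2) (conj b (D (Sum.inl μ)) * (conj b (D (Sum.inr ν)) * Gb)) (fun p q => (gI * Bin) * 1 * Real.exp (-(ρ₁ * (geo9Y x).dist p q))) := by
      rw [← mul_assoc]; exact w3_li μ ν
    have h := hasL2Majorant_cross_left b (bT (shiftY x.toKIdx)) (bU (UboxY x.toKIdx U)) (Rr := (0 : ℝ)) (H := True) (g := geo9Y x) (fun q : Fin (d + 1) × SiteY x.toKIdx => blkC x.toKIdx ιB q.2) dL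
      (((η : ℂ))⁻¹) 1 d₀ M₂ δ₀ ρ₁ (1 / 12) (1 / 12) ρ₂ Λ (gI * Bin) (fun _ => (1 : ℝ)) (fun _ => zero_le_one) hρ₁0 hM₂ (mul_nonneg hgI0 hBin0) hΛ0 hρ₂0 hr₂
      hρ₂₁ hrepr hdnn htri h261 hT0 hρu hd₀B μ (Gp := conj b (D (Sum.inr ν)) * Gb) hin
    exact hasL2Majorant_mono (g := toB6 (geo9Y x) (0 : ℝ) True) _ h fun p q =>
      mul_le_mul_of_nonneg_right (mul_le_mul_of_nonneg_right (hstep ρ₁ (gI * Bin) hρ₁δ (mul_nonneg hgI0 hBin0)) zero_le_one) (Real.exp_nonneg _)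
  -- SECOND ORDER RIGHT `Gb * D k * D l`: inner switch (inl, inr) at ρ₁; outer (inr, inl) at ρ₁ and (inl, inl) at ρ₂
  have w5_li : ∀ μ ν, HasL2Majorant (g := toB6 (geo9Y x) (0 : ℝ) True) (fun q : (Fin (d + 1) × SiteY x.toKIdx) × ι => blkC x.toKIdx ιB q.1.2) (Gb * conj b (D (Sum.inl μ)) * conj b (D (Sum.inr ν))) (fun p q => (gI * Bin) * 1 * Real.exp (-(ρ₁ * (geo9Y x).dist p q))) :=
    fun μ ν => by
    have h := hasL2Majorant_cross2_right_inner b (bT (shiftY x.toKIdx)) (bU (UboxY x.toKIdx U)) (Rr := (0 : ℝ)) (H := True) (g := geo9Y x)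
      (fun q : Fin (d + 1) × SiteY x.toKIdx => blkC x.toKIdx ιB q.2) dL hη0 1 cP σ₁ d₀ M₂ δ₀ δ₀ (1 / 12) (1 / 12) ρ₁ Λ Λ Bin hcP hσ₁0 hM₂ hBin0 hΛ0 hΛ0 hρ₁0 hr₁ hrepr hdnn
      htri hlen h261 hT0 hTi2 μ ν (hcomm μ ν) hρu (hplaq' μ ν) hd₀FB (hσ ν) heta (Gp := Gb) (r5 μ ν) (r2 μ)
    exact hasL2Majorant_mono (g := toB6 (geo9Y x) (0 : ℝ) True) _ h fun p q =>
      mul_le_mul_of_nonneg_right (mul_le_mul_of_nonneg_right (hstepI ρ₁ Bin hρ₁δ hBin0) zero_le_one) (Real.exp_nonneg _)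
  have w5_rl : ∀ μ ν, HasL2Majorant (g := toB6 (geo9Y x) (0 : ℝ) True) (fun q : (Fin (d + 1) × SiteY x.toKIdx) × ι => blkC x.toKIdx ιB q.1.2) (Gb * conj b (D (Sum.inr μ)) * conj b (D (Sum.inl ν))) (fun p q => (gX * Bin) * 1 * Real.exp (-(ρ₁ * (geo9Y x).dist p q))) :=
    fun μ ν => by
    have h := hasL2Majorant_cross_right b (bT (shiftY x.toKIdx)) (bU (UboxY x.toKIdx U)) (Rr := (0 : ℝ)) (H := True) (g := geo9Y x) (fun q : Fin (d + 1) × SiteY x.toKIdx => blkC x.toKIdx ιB q.2) dL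
      (((η : ℂ))⁻¹) 1 d₀ M₂ δ₀ δ₀ (1 / 12) (1 / 12) ρ₁ Λ Bin (fun _ => (1 : ℝ)) (fun _ => zero_le_one) hM₂ hBin0 hΛ hρ₁0 hr₁ hαδ hrepr hdnn htri h261
      hρu hd₀F ν (Gp := Gb * conj b (D (Sum.inr μ))) (r5 μ ν)
    exact hasL2Majorant_mono (g := toB6 (geo9Y x) (0 : ℝ) True) _ h fun p q =>
      mul_le_mul_of_nonneg_right (mul_le_mul_of_nonneg_right (hstep ρ₁ Bin hρ₁δ hBin0) zero_le_one) (Real.exp_nonneg _)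
  have w5_ll : ∀ μ ν, HasL2Majorant (g := toB6 (geo9Y x) (0 : ℝ) True) (fun q : (Fin (d + 1) × SiteY x.toKIdx) × ι => blkC x.toKIdx ιB q.1.2) (Gb * conj b (D (Sum.inl μ)) * conj b (D (Sum.inl ν))) (fun p q => (gX * (gI * Bin)) * 1 * Real.exp (-(ρ₂ * (geo9Y x).dist p q))) :=
    fun μ ν => by
    have h := hasL2Majorant_cross_right b (bT (shiftY x.toKIdx)) (bU (UboxY x.toKIdx U)) (Rr := (0 : ℝ)) (H := True) (g := geo9Y x) (fun q : Fin (d + 1) × SiteY x.toKIdx => blkC x.toKIdx ιB q.2) dL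
      (((η : ℂ))⁻¹) 1 d₀ M₂ δ₀ ρ₁ (1 / 12) (1 / 12) ρ₂ Λ (gI * Bin) (fun _ => (1 : ℝ)) (fun _ => zero_le_one) hM₂ (mul_nonneg hgI0 hBin0) hΛ hρ₂0 hr₂ hαδ
      hrepr hdnn htri h261 hρu hd₀F ν (Gp := Gb * conj b (D (Sum.inl μ))) (w5_li μ ν)
    exact hasL2Majorant_mono (g := toB6 (geo9Y x) (0 : ℝ) True) _ h fun p q =>
      mul_le_mul_of_nonneg_right (mul_le_mul_of_nonneg_right (hstep ρ₂ (gI * Bin) (hρ₂₁.trans hρ₁δ) (mul_nonneg hgI0 hBin0)) zero_le_one)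
        (Real.exp_nonneg _)
  -- assemble: common constant `Bx = g_X²·g_I·Bin`, common rate `δ₀/2`
  have hBx0 : 0 ≤ Bx := by rw [hBx]; positivity
  have hle1 : Bin ≤ Bx := by
    rw [hBx]
    calc Bin ≤ gI * Bin := le_mul_of_one_le_left hBin0 hgI1
      _ ≤ gX ^ 2 * (gI * Bin) := le_mul_of_one_le_left (mul_nonneg hgI0 hBin0) (one_le_pow₀ hgX1)
      _ = gX ^ 2 * gI * Bin := by ring
  have hle2 : gX * Bin ≤ Bx := by
    rw [hBx]
    calc gX * Bin ≤ gX * (gI * Bin) := mul_le_mul_of_nonneg_left (le_mul_of_one_le_left hBin0 hgI1) hgX0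
      _ ≤ gX * (gX * (gI * Bin)) := mul_le_mul_of_nonneg_left (le_mul_of_one_le_left (mul_nonneg hgI0 hBin0) hgX1) hgX0
      _ = gX ^ 2 * gI * Bin := by ring
  have hle3 : gI * Bin ≤ Bx := by
    rw [hBx]
    calc gI * Bin ≤ gX ^ 2 * (gI * Bin) := le_mul_of_one_le_left (mul_nonneg hgI0 hBin0) (one_le_pow₀ hgX1)
      _ = gX ^ 2 * gI * Bin := by ring
  have hle4 : gX * (gI * Bin) ≤ Bx := by
    rw [hBx]
    calc gX * (gI * Bin) ≤ gX * (gX * (gI * Bin)) := mul_le_mul_of_nonneg_left (le_mul_of_one_le_left (mul_nonneg hgI0 hBin0) hgX1) hgX0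
      _ = gX ^ 2 * gI * Bin := by ring
  have hle5 : gX * (gX * Bin) ≤ Bx := by
    rw [hBx]
    calc gX * (gX * Bin) ≤ gX * (gX * (gI * Bin)) :=
          mul_le_mul_of_nonneg_left (mul_le_mul_of_nonneg_left (le_mul_of_one_le_left hBin0 hgI1) hgX0) hgX0
      _ = gX ^ 2 * gI * Bin := by ring
  have mono : ∀ {Tm : Module.End ℝ ((Fin (d + 1) × SiteY x.toKIdx) × ι → ℝ)} {Bc r : ℝ} (w : (geo9Y x).Site → ℝ), (∀ p, 0 ≤ w p) → 0 ≤ Bc → Bc ≤ Bx →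
      δ₀ / 2 ≤ r →
      HasL2Majorant (g := toB6 (geo9Y x) (0 : ℝ) True) (fun q : (Fin (d + 1) × SiteY x.toKIdx) × ι => blkC x.toKIdx ιB q.1.2) Tm (fun p q => Bc * w p * Real.exp (-(r * (geo9Y x).dist p q))) →
      HasL2Majorant (g := toB6 (geo9Y x) (0 : ℝ) True) (fun q : (Fin (d + 1) × SiteY x.toKIdx) × ι => blkC x.toKIdx ιB q.1.2) Tm (fun p q => cLGY cP M₂ (∑ j, ‖b j‖) (Real.sqrt (Fintype.card ι)) d dL δ₀ Λ * B₀ * w p * Real.exp (-(δ₀ / 2 * (geo9Y x).dist p q))) := by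
    intro Tm Bc r w hw hBc hBcx hr h
    have h' := hasL2Majorant_rate_mono (R := (0 : ℝ)) (H := True) (g := geo9Y x) _ Bc w hBc hw hr hdnn h
    exact hasL2Majorant_mono (g := toB6 (geo9Y x) (0 : ℝ) True) _ h' fun p q => by
      rw [← hBxdef]; exact mul_le_mul_of_nonneg_right (mul_le_mul_of_nonneg_right hBcx (hw p)) (Real.exp_nonneg _)
  have h01 : δ₀ / 2 ≤ ρ₁ := by rw [hρ₁]; linarith
  have h02 : δ₀ / 2 ≤ ρ₂ := by rw [hρ₂]; linarith
  have h00 : δ₀ / 2 ≤ δ₀ := by linarith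
  have hw0 : ∀ _p : (geo9Y x).Site, (0 : ℝ) ≤ 1 := fun _ => zero_le_one
  refine ⟨?_, fun k => ?_, fun k => ?_, fun k l => ?_, fun k l => ?_, fun k l => ?_⟩
  · exact mono (fun p => (geo9Y x).len p ^ 2) (fun p => sq_nonneg _) hBin0 hle1 h00 r0'
  · cases k with
    | inl μ => exact mono (fun p => (geo9Y x).len p) hwℓ hBin0 hle1 h00 (r1 μ)
    | inr μ => exact mono (fun p => (geo9Y x).len p) hwℓ (mul_nonneg hgX0 hBin0) hle2 h01 (x1 μ)
  · cases k with
    | inl μ => exact mono (fun p => (geo9Y x).len p) hwℓ (mul_nonneg hgX0 hBin0) hle2 h01 (x2 μ)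
    | inr μ => exact mono (fun p => (geo9Y x).len p) hwℓ hBin0 hle1 h00 (r2 μ)
  · cases k with
    | inl μ =>
      cases l with
      | inl ν => exact mono (fun _ => (1 : ℝ)) hw0 hBin0 hle1 h00 (r3 μ ν)
      | inr ν => exact mono (fun _ => (1 : ℝ)) hw0 (mul_nonneg hgI0 hBin0) hle3 h01 (w3_li μ ν)
    | inr μ =>
      cases l with
      | inl ν =>
        rw [mul_assoc]
        exact mono (fun _ => (1 : ℝ)) hw0 (mul_nonneg hgX0 hBin0) hle2 h01 (w3_rl μ ν)
      | inr ν =>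
        rw [mul_assoc]
        exact mono (fun _ => (1 : ℝ)) hw0 (mul_nonneg hgX0 (mul_nonneg hgI0 hBin0)) hle4 h02 (w3_rr μ ν)
  · cases k with
    | inl μ =>
      cases l with
      | inl ν => exact mono (fun _ => (1 : ℝ)) hw0 (mul_nonneg hgX0 hBin0) hle2 h01 (m_ll μ ν)
      | inr ν => exact mono (fun _ => (1 : ℝ)) hw0 hBin0 hle1 h00 (r4 μ ν)
    | inr μ =>
      cases l with
      | inl ν =>
        rw [mul_assoc]
        exact mono (fun _ => (1 : ℝ)) hw0 (mul_nonneg hgX0 (mul_nonneg hgX0 hBin0)) hle5 h02 (m_rl μ ν)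
      | inr ν =>
        rw [mul_assoc]
        exact mono (fun _ => (1 : ℝ)) hw0 (mul_nonneg hgX0 hBin0) hle2 h01 (m_rr μ ν)
  · cases k with
    | inl μ =>
      cases l with
      | inl ν => exact mono (fun _ => (1 : ℝ)) hw0 (mul_nonneg hgX0 (mul_nonneg hgI0 hBin0)) hle4 h02 (w5_ll μ ν)
      | inr ν => exact mono (fun _ => (1 : ℝ)) hw0 (mul_nonneg hgI0 hBin0) hle3 h01 (w5_li μ ν)
    | inr μ =>
      cases l with
      | inl ν => exact mono (fun _ => (1 : ℝ)) hw0 (mul_nonneg hgX0 hBin0) hle2 h01 (w5_rl μ ν)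
      | inr ν => exact mono (fun _ => (1 : ℝ)) hw0 hBin0 hle1 h00 (r5 μ ν)

end All

end Literature.MathematicalPhysics.QuantumFieldTheory.Balaban1983to89.B9SectBL2GCrossY

end
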